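import Summits.CriticalPhenomena.PercolationContinuityZ3.Theorems.PercNearOneGluingNoHeavyRsw3AnnulusCriticalPointIff
import Summits.CriticalPhenomena.PercolationContinuityZ3.Theorems.PercNearOneGluingNoHeavyRsw3AnnulusSqrtWindow
import Summits.CriticalPhenomena.PercolationContinuityZ3.Theorems.PercNearOneGluingNoHeavyQuantExplicitRateElementary
import HarnessLib

/-!
# RSW3 lane (P2, method "3D RSW-lite from continuity"): the critical annulus window with EXPLICIT
# functions on both sides — `(2d)⁻¹(L/16N)^{d-1} ≤ u_{p_c}(L,N)² ` and
# `u_{p_c}(L,N) ≤ (2L+1)^d (1 - η_d)^{⌊log*_{b_d}(N-L-1)/3⌋}` (`d ≥ 3`)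

builds on p205010 (kernel theorem, internal audit signed; external expert review pending)

Cell `prim-rsw3` (post-continuity programme, LANE 3), prover seat `prim-rsw3-p2` (gen 2), memo
`run/shared/lean/prim/rsw3/P2-RSWLITE.md` §7c.  Support file (`--supports stmt-CriticalPhenomena-4575`);
no definitions, no named facts, no sorries.  `u_p(L,N) = P_p(boxCrossing d L N) = P_p(Λ(L) ↔ ∂ⁱⁿΛ(N) in Λ(N))`.

* `real_boxCrossing_criticalProbI_le_explicit` — the one-arm envelope `u ≤ (2L+1)^d π_{p_c}(N-L-1)`
  (`Rsw3.real_boxCrossing_le_card_mul_oneArmProb`) fed with LANE 1's explicit one-arm rate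
  `Quant.oneArm_explicit_rate_elementary` (`π_{p_c}(n) ≤ (1 - knEta d)^{⌊log*_{knBase d}(n)/3⌋}`, `d ≥ 3`,
  Kozma–Nitzan §4 with additive gluing, kernel): for `L < N`,
  `u_{p_c}(L,N) ≤ (2L+1)^d (1 - knEta d)^{⌊log*_{knBase d}(N-L-1)/3⌋}` — the quantitative form of the
  free-outer-scale collapse (Y) of `…Rsw3CrossingWindow` (there: `u_{p_c}(L,N) → 0` from `θ(p_c) = 0`).
* `criticalWindow_explicit_three` — **`d = 3`, both sides explicit**: for all `1 ≤ L < N`,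
  `L/(40N) ≤ P_{p_c(ℤ³)}(Λ(L) ↔ ∂ⁱⁿΛ(N) in Λ(N)) ≤ (2L+1)³ (1 - knEta 3)^{⌊log*_{knBase 3}(N-L-1)/3⌋}`.
  Honest size: the right side decays like an inverse TOWER function (`knEta 3 ≈ 2^{-12568}`,
  `knBase 3 ≈ 2^{7.8·10⁵}`); the hyperscaling statement X_B = `CritAnnulusNonCrossing` would replace it by
  `1 - c` at `N = 2L`, and LANE 1's PACD by `1 - δ` at `N = L^α`.

References: G. Kozma, A. Nitzan (2024) §4 Thm. 6; H. Kesten (1982) Thm. 5.1 / Cor. 5.1. [folklore]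
-/

noncomputable section

namespace Summit.CriticalPhenomena.PercolationContinuityZ3.Theorems

open MeasureTheory ProbabilityTheory Filter Topology
open Literature.Probability.Percolation Literature.Probability.LatticeModels
open Literature.Probability.Percolation.CerfDembinVanishing

namespace Rsw3

open SurfaceTension Quant

variable {d : ℕ}

/-- **Explicit upper envelope of the critical annulus crossing (`d ≥ 3`).** For `L < N`:
`u_{p_c}(L,N) ≤ (2L+1)^d (1 - knEta d)^{⌊log*_{knBase d}(N-L-1)/3⌋}`.
[cite: KozmaNitzan2024, §4 Theorem 6] -/
theorem real_boxCrossing_criticalProbI_le_explicit [NeZero d] (hd : 3 ≤ d) {L N : ℕ} (hLN : L < N) :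
    (bondPercolation (zdGraph d) (criticalProbI d)).real (boxCrossing d L N) ≤
      (2 * (L : ℝ) + 1) ^ d * (1 - knEta d) ^ (logStar (knBase d) (N - L - 1) / 3) :=
  (real_boxCrossing_le_card_mul_oneArmProb (criticalProbI d) hLN).trans
    (mul_le_mul_of_nonneg_left (oneArm_explicit_rate_elementary hd (N - L - 1)) (by positivity))

/-- **The critical annulus window of `ℤ³` with explicit functions on both sides.** For all
`1 ≤ L < N`: `L/(40N) ≤ P_{p_c(ℤ³)}(Λ(L) ↔ ∂ⁱⁿΛ(N) in Λ(N)) ≤ (2L+1)³ (1 - knEta 3)^{⌊log*_{knBase 3}(N-L-1)/3⌋}`.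
[cite: KozmaNitzan2024, §4 Theorem 6] [cite: Kesten1982, Cor. 5.1] -/
theorem criticalWindow_explicit_three {L N : ℕ} (hL : 1 ≤ L) (hLN : L < N) :
    (L : ℝ) / (40 * N) ≤ (bondPercolation (zdGraph 3) (criticalProbI 3)).real (boxCrossing 3 L N) ∧
      (bondPercolation (zdGraph 3) (criticalProbI 3)).real (boxCrossing 3 L N) ≤
        (2 * (L : ℝ) + 1) ^ 3 * (1 - knEta 3) ^ (logStar (knBase 3) (N - L - 1) / 3) :=
  ⟨le_real_boxCrossing_criticalProbI_three_sqrt hL hLN.le,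
    real_boxCrossing_criticalProbI_le_explicit (d := 3) le_rfl hLN⟩

end Rsw3

end Summit.CriticalPhenomena.PercolationContinuityZ3.Theorems

end
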